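import Summits.SmoothPoincare4.SmoothPoincare4.Theses.SymplecticOrigami
import Summits.SmoothPoincare4.SmoothPoincare4.Theorems.SymplecticOrigamiOrigamiRungStubSphereOfGenusZero
import Literature.AlgebraicTopology.SingularHomology.Orientation
import Literature.AlgebraicTopology.SingularHomology.OrientationProofs
import Literature.AlgebraicTopology.SingularHomology.PoincareDuality
import Literature.AlgebraicTopology.SingularHomology.PoincareDualityProofs
import Literature.AlgebraicTopology.SingularHomology.PoincareDualityCorollaries
import Literature.AlgebraicTopology.SingularHomology.DisjointCarriersCupPairing
import Literature.AlgebraicTopology.SingularHomology.ModPBettiNumbers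
import Literature.AlgebraicTopology.SingularHomology.IntersectionForm
import Literature.AlgebraicTopology.SingularHomology.IntersectionFormProofs
import Literature.AlgebraicTopology.SingularHomology.CupProductProofs
import Literature.AlgebraicTopology.SingularHomology.CohomologyFiniteness
import Literature.AlgebraicTopology.SingularHomology.ClosedManifoldHomologyProofs
import Literature.AlgebraicTopology.SingularHomology.HomologySpheres
import Literature.Topology.FourManifolds.IntersectionLatticeProofs
import Literature.Topology.FourManifolds.IntersectionFormTopologyRankProofs
import Literature.Topology.FourManifolds.IntersectionLatticeOrientationProofs
import Literature.Topology.FourManifolds.LatticeFormsDefinite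
import Literature.Geometry.Kaehler.ManifoldFormsPullback
import Literature.Geometry.Symplectic.SymplecticHomologicalOrientation
import Literature.Geometry.Symplectic.SymplecticSurfaceNonTorsion
import Literature.Geometry.Symplectic.TaubesCanonicalClassSymplecticCurveFourProofs

/-!
# Bookkeeping lemmas for the pinch of line `pair-rigidity-endgame` (crux `SymplecticOrigami.OrigamiRung`)

Helper file of the lead's composition `stub_pinch_of_parity` (item stmt-SmoothPoincare4-7843,
route `route-SmoothPoincare4-SymplecticOrigami`), which derives the SW-free integral pinch from
the five landed reshape-r3 stubs by rank bookkeeping over `ℚ` and every `𝔽ₚ`.  This file holds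
the pieces of that bookkeeping that do not mention the fold:

* `pinch_arith` — the linear arithmetic of one field and one piece (`omega`);
* `log_card_ker_zsmul_eq_zero_of_torsion_eq_bot`, `torsion_eq_bot_of_free`,
  `nonempty_addEquiv_pi_of_card_ker` — a finitely generated abelian group without `p`-torsion
  for every prime `p` is `≃+ ℤ^{rank}` (how `H₁(N ∖ B; ℤ) ≅ ℤᵏ` is concluded);
* `nonempty_orientation_surface` — a surface on which a smooth `2`-form is non-degenerate is
  `ℤ`-oriented (the area form `b^* s`, landed `isOrientable_of_isSmoothForm_of_ne_zero`);
* `even_bettiNumber_one_of_carried` — **the isotropic piece** (registered sub-goal of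
  stmt-SmoothPoincare4-7843): a closed connected symplectic `(N, s)` with `b₂ = 2` in which the
  class of a symplectic surface `B` is carried by a set disjoint from `B` has `B · B = 0`
  (`cupPairing_eq_zero_of_disjoint_carriers`, PROVED Bredon VI.11.10) for a non-torsion class
  (`map_fundamentalClass_not_mem_torsion_of_isSmoothEmbedding`), hence an indefinite unimodular
  rank-`2` lattice (`exists_apply_self_neg_of_isotropic`), so `b⁺ = 1` for the symplectic
  orientation (`exists_isSymplecticOrientationOf_one_le_sigPos`), and the parity of
  `1 - b₁ + b⁺` (hypothesis) makes `b₁(N)` even;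
* `bettiNumber_zmod_one_eq`, `bettiNumber_zmod_closed_four` — mod-`p` Betti numbers
  (`finrank_singularHomology_zmod_succ`, Hatcher Cor. 3A.6 (b)): `b₁(Y; 𝔽ₚ) = b₁ + t_p(H₁)` for
  a path-connected `Y`, and for a closed oriented `4`-manifold `b₂(N; 𝔽ₚ) = b₂ + 2 t_p(H₁)`
  (Poincaré duality mod `p`, `H₃` torsion-free).

Everything is proved; no definitions, no named facts.
-/

noncomputable section

-- the prescribed namespace `Summit.<P>.<Sub>.…` duplicates `SmoothPoincare4` (P = Sub)
set_option linter.dupNamespace false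

open scoped Manifold ContDiff Topology ContinuousMap
open Set TopologicalSpace
open Literature.Geometry.Kaehler (MForm IsSmoothForm IsClosedForm)
open Literature.AlgebraicTopology.SingularHomology (singularHomology HomologicalOrientation
  singularCohomology poincareDualityMap cupPairing intersectionForm bettiNumber freeCohomology)

namespace Summit.SmoothPoincare4.SmoothPoincare4.Theorems.OrigamiRung.PairRigidityEndgame

/-! ## Arithmetic of the pinch -/

/-- **The rank bookkeeping, one field, both pieces.**  From Alexander duality
(`r = a₀ + a₁`, `a₀ = c₁`, `a₁ = c₀`, `t₀ = t₁ = 0`), the piece relations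
(`nᵢ ≤ aᵢ ≤ nᵢ + 1`, `cᵢ + 2nᵢ + 1 = sᵢ + mᵢ + aᵢ + tᵢ`), the neighbourhood pair
(`sᵢ ≤ r ≤ sᵢ + 1`) and `1 ≤ mᵢ`: `aᵢ = nᵢ` and `mᵢ + sᵢ = r + 1`. [folklore] -/
theorem pinch_arith {r a c t n m s : ℕ} {a' c' : ℕ}
    (hr : r = a + a') (hac : a = c') (hac' : a' = c) (ht : t = 0)
    (hn : n ≤ a) (hn' : a ≤ n + 1) (hrel : c + 2 * n + 1 = s + m + a + t)
    (hs : s ≤ r) (hs' : r ≤ s + 1) (hm : 1 ≤ m) :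
    a = n ∧ m + s = r + 1 := by
  omega

/-! ## Torsion bookkeeping in finitely generated abelian groups -/

section Torsion

open Literature.AlgebraicTopology.SingularHomology

/-- In a torsion-free `ℤ`-module the `p`-torsion subgroup is trivial, so its order has
`log_p = 0`. [folklore] -/
theorem log_card_ker_zsmul_eq_zero_of_torsion_eq_bot {G : Type*} [AddCommGroup G]
    [inst : Module ℤ G] (h : Submodule.torsion ℤ G = ⊥) (p : ℕ) (hp : p.Prime) :
    Nat.log p (Nat.card (zsmulAddGroupHom (α := G) (p : ℤ)).ker) = 0 := by
  obtain rfl : inst = AddCommGroup.toIntModule G := Subsingleton.elim _ _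
  have hbot : (zsmulAddGroupHom (α := G) (p : ℤ)).ker = ⊥ := by
    rw [eq_bot_iff]
    intro x hx
    rw [AddMonoidHom.mem_ker, zsmulAddGroupHom_apply] at hx
    have hxt : x ∈ Submodule.torsion ℤ G := by
      refine (Submodule.mem_torsion_iff x).2 ⟨⟨(p : ℤ), ?_⟩, hx⟩
      exact mem_nonZeroDivisors_of_ne_zero (by exact_mod_cast hp.ne_zero)
    rw [h] at hxt
    exact (Submodule.mem_bot ℤ).1 hxt
  rw [hbot, AddSubgroup.card_bot, Nat.log_one_right]

/-- A free `ℤ`-module is torsion-free. [folklore] -/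
theorem torsion_eq_bot_of_free {G : Type*} [AddCommGroup G] [Module ℤ G] [Module.Free ℤ G] :
    Submodule.torsion ℤ G = ⊥ :=
  Submodule.isTorsionFree_iff_torsion_eq_bot.1 inferInstance

/-- **A finitely generated abelian group without `p`-torsion for every prime `p` is free of rank
`rank_ℤ`**, as an additive group `≃+ ℤ^k`. [folklore] -/
theorem nonempty_addEquiv_pi_of_card_ker {G : Type*} [AddCommGroup G] [inst : Module ℤ G]
    [Module.Finite ℤ G]
    (h : ∀ p : ℕ, p.Prime → Nat.log p (Nat.card (zsmulAddGroupHom (α := G) (p : ℤ)).ker) = 0)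
    {k : ℕ} (hk : Module.finrank ℤ G = k) : Nonempty (G ≃+ (Fin k → ℤ)) := by
  obtain rfl : inst = AddCommGroup.toIntModule G := Subsingleton.elim _ _
  -- no torsion: an element of finite additive order `n > 1` yields `p`-torsion for `p ∣ n`
  have htf : Submodule.torsion ℤ G = ⊥ := by
    rw [eq_bot_iff]
    intro x hx
    rw [Submodule.mem_bot]
    by_contra hx0
    obtain ⟨⟨a, ha⟩, hax⟩ := (Submodule.mem_torsion_iff x).1 hx
    change a • x = 0 at hax
    have ha0 : a ≠ 0 := nonZeroDivisors.ne_zero ha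
    -- the additive order of `x` is finite and `> 1`
    have hfin : IsOfFinAddOrder x := by
      rw [isOfFinAddOrder_iff_zsmul_eq_zero]
      exact ⟨a, ha0, hax⟩
    have hord : 1 < addOrderOf x := by
      have h1 := hfin.addOrderOf_pos
      rcases Nat.lt_or_ge 1 (addOrderOf x) with hlt | hle
      · exact hlt
      · exfalso
        have heq : addOrderOf x = 1 := by omega
        exact hx0 (AddMonoid.addOrderOf_eq_one_iff.1 heq)
    obtain ⟨p, hp, hpd⟩ := Nat.exists_prime_and_dvd hord.ne'
    obtain ⟨q, hq⟩ := hpd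
    -- `y = q • x` is a non-zero element of `p`-torsion
    have hy0 : q • x ≠ 0 := by
      intro hy
      have hdvd := addOrderOf_dvd_of_nsmul_eq_zero hy
      rw [hq] at hdvd
      have hqpos : 0 < q := by
        rcases Nat.eq_zero_or_pos q with h0 | h0
        · rw [h0, mul_zero] at hq; omega
        · exact h0
      have := Nat.le_of_dvd hqpos hdvd
      have hp2 := hp.two_le
      nlinarith
    have hy : (p : ℤ) • (q • x) = 0 := by
      rw [natCast_zsmul, ← mul_nsmul', ← hq, addOrderOf_nsmul_eq_zero]
    have hmem : q • x ∈ (zsmulAddGroupHom (α := G) (p : ℤ)).ker := by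
      rw [AddMonoidHom.mem_ker, zsmulAddGroupHom_apply]; exact hy
    haveI : Fact p.Prime := ⟨hp⟩
    have hfinker : Finite (zsmulAddGroupHom (α := G) (p : ℤ)).ker :=
      (Nat.card_quotient_zsmulRange_eq (G := G) hp.pos).2.2
    have hcard := Nat.card_ker_zsmul_eq_pow (p := p) G
    rw [h p hp, pow_zero] at hcard
    have huniq := (Nat.card_eq_one_iff_unique.1 hcard).1
    have : (⟨q • x, hmem⟩ : (zsmulAddGroupHom (α := G) (p : ℤ)).ker) = ⟨0, zero_mem _⟩ :=
      Subsingleton.elim _ _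
    exact hy0 (congrArg Subtype.val this)
  haveI : Module.IsTorsionFree ℤ G := Submodule.isTorsionFree_iff_torsion_eq_bot.2 htf
  haveI : Module.Free ℤ G := Module.free_of_finite_type_torsion_free'
  exact ⟨((Module.finBasisOfFinrankEq ℤ G hk).equivFun).toAddEquiv⟩

end Torsion

/-! ## The isotropic piece: `b₂ = 2` with `[B]` carried by the complement forces `b₁` even -/

section Isotropic

open Literature.AlgebraicTopology.SingularHomology Literature.Geometry.Symplectic Module

/-- **Orientation of a symplectic surface.**  If the smooth `2`-form `s` is non-degenerate on the
image of the smooth embedding `b : S → N` of a compact surface, `S` carries a homological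
`ℤ`-orientation (the area form `b^* s` vanishes nowhere). [folklore] -/
theorem nonempty_orientation_surface {N : Type} [TopologicalSpace N] [T2Space N]
    [ChartedSpace (EuclideanSpace ℝ (Fin 4)) N] [IsManifold (𝓡 4) ∞ N]
    (s : MForm (𝓡 4) N ℝ 2)
    {S : Type} [TopologicalSpace S] [CompactSpace S] [ChartedSpace (EuclideanSpace ℝ (Fin 2)) S]
    [IsManifold (𝓡 2) ∞ S] {b : S → N} (hs : IsSmoothForm s)
    (hb : Manifold.IsSmoothEmbedding (𝓡 2) (𝓡 4) ∞ b)
    (hnd : ∀ y (v : TangentSpace (𝓡 2) y), v ≠ 0 → ∃ w : TangentSpace (𝓡 2) y,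
      s (b y) ![mfderiv (𝓡 2) (𝓡 4) b y v, mfderiv (𝓡 2) (𝓡 4) b y w] ≠ 0) :
    Nonempty (HomologicalOrientation ℤ S 2) := by
  haveI : T2Space S := hb.isEmbedding.t2Space
  have hβ : IsSmoothForm (s.pullback (𝓡 2) b) :=
    Literature.Geometry.Kaehler.isSmoothFormPullback_holds (𝓡 2) S (𝓡 4) N ℝ hb.contMDiff hs
  have hne : ∀ y, s.pullback (𝓡 2) b y ≠ 0 := fun y h0 => by
    have hv :
        ((EuclideanSpace.basisFun (Fin 2) ℝ).toBasis 0 : EuclideanSpace ℝ (Fin 2)) ≠ 0 :=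
      Module.Basis.ne_zero _ 0
    obtain ⟨w, hw⟩ := hnd y ((EuclideanSpace.basisFun (Fin 2) ℝ).toBasis 0) hv
    apply hw
    have h1 : s.pullback (𝓡 2) b y ![(EuclideanSpace.basisFun (Fin 2) ℝ).toBasis 0, w] = 0 := by
      rw [h0]
      rfl
    rw [Literature.Geometry.Kaehler.MForm.pullback_apply] at h1
    convert h1 using 2
    funext i
    fin_cases i <;> rfl
  exact Literature.Topology.FourManifolds.isOrientableOver_int_of_isOrientable_holds S
    (isOrientable_of_isSmoothForm_of_ne_zero hβ hne)

/-- **The isotropic piece.**  Let `(N, s)` be a closed connected symplectic `4`-manifold with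
`b₂(N) = 2`, `b : S ↪ N` a compact connected surface on which `s` is non-degenerate, and suppose
every class `b_* c` is carried by a subset `G(Y)` disjoint from `b(S)`.  Then `B · B = 0` for the
Poincaré dual of the non-torsion class `b_*[S]` (disjoint carriers), the unimodular intersection
lattice of the symplectic orientation `μ` is indefinite of rank `2`, so `b⁺(μ) = 1`; the parity
of `1 - b₁ + b⁺(μ)` (hypothesis `hP`, the Literature fact
`even_one_add_bOne_add_bPlus_of_symplectic_four` for this `(N, s)`) then makes `b₁(N)` even.
[folklore] -/
theorem even_bettiNumber_one_of_carried
    (N : Type) [TopologicalSpace N] [T2Space N] [SecondCountableTopology N] [CompactSpace N]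
    [ConnectedSpace N] [ChartedSpace (EuclideanSpace ℝ (Fin 4)) N] [IsManifold (𝓡 4) ∞ N]
    (s : MForm (𝓡 4) N ℝ 2) (hs : IsSmoothForm s) (hcl : IsClosedForm s)
    (hnd : ∀ x (v : TangentSpace (𝓡 4) x), v ≠ 0 → ∃ w, s x ![v, w] ≠ 0)
    (hP : ∀ μ : HomologicalOrientation ℤ N 4, μ.IsSymplecticOrientationOf s hs hcl →
      Even (1 + Module.finrank ℤ (singularHomology ℤ ℤ N 1) +
        sigPos (intersectionForm two_add_two_eq_four μ).toQuadraticMap))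
    (S : Type) [TopologicalSpace S] [CompactSpace S] [ConnectedSpace S]
    [ChartedSpace (EuclideanSpace ℝ (Fin 2)) S]
    [IsManifold (𝓡 2) ∞ S] (b : S → N) (hb : Manifold.IsSmoothEmbedding (𝓡 2) (𝓡 4) ∞ b)
    (hbnd : ∀ y (v : TangentSpace (𝓡 2) y), v ≠ 0 → ∃ w : TangentSpace (𝓡 2) y,
      s (b y) ![mfderiv (𝓡 2) (𝓡 4) b y v, mfderiv (𝓡 2) (𝓡 4) b y w] ≠ 0)
    (hm : bettiNumber ℚ N 2 = 2)
    {Y : Type} [TopologicalSpace Y] (G : C(Y, N)) (hG : Disjoint (Set.range b) (Set.range G))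
    (hcar : ∀ c : singularHomology ℤ ℤ S 2, ∃ d : singularHomology ℤ ℤ Y 2,
      singularHomology.map ℤ ℤ G 2 d = singularHomology.map ℤ ℤ ⟨b, hb.isEmbedding.continuous⟩ 2 c) :
    Even (bettiNumber ℤ N 1) := by
  -- the symplectic orientation and `b⁺ ≥ 1`
  obtain ⟨μ, hμ, hpos⟩ := exists_isSymplecticOrientationOf_one_le_sigPos s hs hcl hnd
  -- an orientation of the surface; `b_*[S]` is not torsion
  obtain ⟨μS⟩ := nonempty_orientation_surface s hs hb hbnd
  have htor := map_fundamentalClass_not_mem_torsion_of_isSmoothEmbedding s hs hcl b hb hbnd μS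
  -- the Poincaré dual `σ` of `b_*[S]` and `σ ⌣ σ = 0` by disjoint carriers
  obtain ⟨σ, hσ⟩ := (poincare_duality μ (two_add_two_eq_four : 2 + 2 = 4)).2
    (singularHomology.map ℤ ℤ ⟨b, hb.isEmbedding.continuous⟩ 2 μS.fundamentalClass)
  obtain ⟨d, hd⟩ := hcar μS.fundamentalClass
  have hcup : cupPairing μ two_add_two_eq_four σ σ = 0 :=
    cupPairing_eq_zero_of_disjoint_carriers μ two_add_two_eq_four two_add_two_eq_four
      ⟨b, hb.isEmbedding.continuous⟩ hσ G (hσ.trans hd.symm)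
      (isCompact_range hb.isEmbedding.continuous).isClosed hG
  -- the lattice `L = H²(N; ℤ)/T` with its unimodular symmetric form `Q`
  have hU := Literature.Topology.FourManifolds.isUnimodular_intersectionForm_holds (X := N)
    two_add_two_eq_four μ
  have hsum := Literature.Topology.FourManifolds.finrank_eq_sigPos_add_sigNeg_intersectionForm_holds
    (X := N) even_two two_add_two_eq_four μ
  have hsymm : (intersectionForm two_add_two_eq_four μ).IsSymm :=
    isSymm_intersectionForm (cupProduct_gradedComm_holds ℤ N) even_two two_add_two_eq_four μ
  have hmk : ∀ a a' : singularCohomology ℤ ℤ N 2, cupPairing μ two_add_two_eq_four a a' =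
      intersectionForm two_add_two_eq_four μ (freeCohomology.mk a) (freeCohomology.mk a') :=
    fun _ _ => rfl
  obtain ⟨Q, hQdef⟩ : ∃ Q : LinearMap.BilinForm ℤ ↥(freeCohomology ℤ N 2),
      intersectionForm two_add_two_eq_four μ = Q := ⟨_, rfl⟩
  rw [hQdef] at hU hsum hsymm hmk hpos
  haveI : Module.Finite ℤ ↥(freeCohomology ℤ N 2) := finite_freeCohomology
    (finite_singularCohomology_of_compactSpace_of_isPrincipalIdealRing ℤ N 4 2)
  have hrank : Module.finrank ℤ ↥(freeCohomology ℤ N 2) = 2 := by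
    rw [Literature.Topology.FourManifolds.finrank_freeCohomology_two_eq_bettiNumber_of_compactSpace]
    exact hm
  -- `x = [σ] ≠ 0` is isotropic
  set x : ↥(freeCohomology ℤ N 2) := freeCohomology.mk σ with hxdef
  have hxx : Q x x = 0 := by rw [← hmk, hcup]
  have hx0 : x ≠ 0 := by
    intro h0
    apply htor
    rw [← hσ]
    exact Submodule.mem_comap.1 (freeCohomology.torsion_le_comap_torsion
      (poincareDualityMap μ two_add_two_eq_four) ((freeCohomology.mk_eq_zero_iff σ).1 h0))
  -- unimodular ⇒ some `z` pairs non-trivially with `x` ⇒ `Q` takes a negative value ⇒ `b⁻ ≥ 1`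
  obtain ⟨z, hz⟩ : ∃ z, Q x z ≠ 0 := by
    by_contra hall
    push Not at hall
    exact hx0 (hU.separatingLeft x hall)
  obtain ⟨v, hv⟩ := LinearMap.BilinForm.exists_apply_self_neg_of_isotropic hsymm hxx hz
  have hneg := LinearMap.BilinForm.sigNeg_pos_of_apply_self_neg hv
  have hplus : sigPos Q.toQuadraticMap = 1 := by omega
  -- parity
  have hev := hP μ hμ
  rw [hQdef, hplus] at hev
  have : Even (Module.finrank ℤ (singularHomology ℤ ℤ N 1) + 2) := by
    convert hev using 1; ring
  rw [Nat.even_add] at this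
  exact this.2 (by decide)

/-- **The isotropic piece (registered sub-goal of stmt-SmoothPoincare4-7843, `∀`-form of
`even_bettiNumber_one_of_carried` over fully qualified names).** [folklore] -/
theorem stub_pinch_isotropicPiece :
      ∀ (N : Type) [TopologicalSpace N] [T2Space N] [SecondCountableTopology N] [CompactSpace N]
      [ConnectedSpace N] [ChartedSpace (EuclideanSpace ℝ (Fin 4)) N] [IsManifold (𝓡 4) ∞ N] (s :
      Literature.Geometry.Kaehler.MForm (𝓡 4) N ℝ 2) (hs :
      Literature.Geometry.Kaehler.IsSmoothForm s) (hcl : Literature.Geometry.Kaehler.IsClosedForm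
      s), (∀ x (v : TangentSpace (𝓡 4) x), v ≠ 0 → ∃ w, s x ![v, w] ≠ 0) → (∀ μ :
      Literature.AlgebraicTopology.SingularHomology.HomologicalOrientation ℤ N 4,
      μ.IsSymplecticOrientationOf s hs hcl → Even (1 + Module.finrank ℤ
      (Literature.AlgebraicTopology.SingularHomology.singularHomology ℤ ℤ N 1) + sigPos
      (Literature.AlgebraicTopology.SingularHomology.intersectionForm two_add_two_eq_four
      μ).toQuadraticMap)) → ∀ (S : Type) [TopologicalSpace S] [CompactSpace S] [ConnectedSpace S]
      [ChartedSpace (EuclideanSpace ℝ (Fin 2)) S] [IsManifold (𝓡 2) ∞ S] (b : S → N) (hb :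
      Manifold.IsSmoothEmbedding (𝓡 2) (𝓡 4) ∞ b), (∀ y (v : TangentSpace (𝓡 2) y), v ≠ 0 → ∃ w :
      TangentSpace (𝓡 2) y, s (b y) ![mfderiv (𝓡 2) (𝓡 4) b y v, mfderiv (𝓡 2) (𝓡 4) b y w] ≠ 0) →
      Literature.AlgebraicTopology.SingularHomology.bettiNumber ℚ N 2 = 2 → ∀ (Y : Type)
      [TopologicalSpace Y] (G : C(Y, N)), Disjoint (Set.range b) (Set.range G) → (∀ c :
      Literature.AlgebraicTopology.SingularHomology.singularHomology ℤ ℤ S 2, ∃ d :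
      Literature.AlgebraicTopology.SingularHomology.singularHomology ℤ ℤ Y 2,
      Literature.AlgebraicTopology.SingularHomology.singularHomology.map ℤ ℤ G 2 d =
      Literature.AlgebraicTopology.SingularHomology.singularHomology.map ℤ ℤ ⟨b,
      hb.isEmbedding.continuous⟩ 2 c) → Even
      (Literature.AlgebraicTopology.SingularHomology.bettiNumber ℤ N 1) :=
  fun N _ _ _ _ _ _ _ s hs hcl hnd hP S _ _ _ _ _ b hb hbnd hm _ _ G hG hcar =>
    even_bettiNumber_one_of_carried N s hs hcl hnd hP S b hb hbnd hm G hG hcar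

end Isotropic

/-! ## Mod-`p` Betti numbers -/

section ModP

open Literature.AlgebraicTopology.SingularHomology Module

/-- `b₁(Y; 𝔽ₚ) = b₁(Y; ℤ) + t_p(H₁(Y; ℤ))` for a path-connected space with finitely generated
`H₁` (Hatcher Cor. 3A.6 (b); `H₀ ≅ ℤ` has no torsion). [folklore] -/
theorem bettiNumber_zmod_one_eq (Y : Type) [TopologicalSpace Y] [PathConnectedSpace Y]
    [Module.Finite ℤ (singularHomology ℤ ℤ Y 1)] (p : ℕ) [hp : Fact p.Prime] :
    bettiNumber (ZMod p) Y 1 = bettiNumber ℤ Y 1 +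
      Nat.log p (Nat.card (zsmulAddGroupHom (α := singularHomology ℤ ℤ Y 1) (p : ℤ)).ker) := by
  haveI : Module.Finite ℤ (singularHomology ℤ ℤ Y 0) :=
    finite_singularHomology_zero_of_pathConnectedSpace
  have h := (finrank_singularHomology_zmod_succ (X := Y) (p := p) 0).1
  haveI : Module.Free ℤ (singularHomology ℤ ℤ Y 0) := free_singularHomology_zero
  have h0 : Nat.log p (Nat.card (zsmulAddGroupHom (α := singularHomology ℤ ℤ Y 0) (p : ℤ)).ker) = 0 :=
    log_card_ker_zsmul_eq_zero_of_torsion_eq_bot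
      (torsion_eq_bot_of_free (G := singularHomology ℤ ℤ Y 0)) p hp.out
  unfold bettiNumber
  rw [h, h0, add_zero]

/-- **Mod-`p` Betti numbers of a closed oriented `4`-manifold**: `b₁(N; 𝔽ₚ) = b₁ + t_p(H₁)` and
`b₂(N; 𝔽ₚ) = b₂ + 2 t_p(H₁)` (`H₀`, `H₃` torsion-free, Poincaré duality mod `p` gives
`t_p(H₂) = t_p(H₁)`). [folklore] -/
theorem bettiNumber_zmod_closed_four (N : Type) [TopologicalSpace N] [T2Space N] [CompactSpace N]
    [ConnectedSpace N] [ChartedSpace (EuclideanSpace ℝ (Fin 4)) N] (μ : HomologicalOrientation ℤ N 4)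
    (p : ℕ) [hp : Fact p.Prime] :
    bettiNumber (ZMod p) N 1 = bettiNumber ℤ N 1 +
        Nat.log p (Nat.card (zsmulAddGroupHom (α := singularHomology ℤ ℤ N 1) (p : ℤ)).ker) ∧
      bettiNumber (ZMod p) N 2 = bettiNumber ℤ N 2 +
        2 * Nat.log p (Nat.card (zsmulAddGroupHom (α := singularHomology ℤ ℤ N 1) (p : ℤ)).ker) := by
  haveI : LocallyPathConnectedSpace N := ChartedSpace.locallyPathConnectedSpace (EuclideanSpace ℝ (Fin 4)) N
  haveI : PathConnectedSpace N := pathConnectedSpace_iff_connectedSpace.2 inferInstance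
  haveI : ∀ k, Module.Finite ℤ (singularHomology ℤ ℤ N k) := fun k =>
    finite_singularHomology_of_compactSpace_holds (R := ℤ) N 4 k
  have h1 := bettiNumber_zmod_one_eq N p
  have h2 := (finrank_singularHomology_zmod_succ (X := N) (p := p) 1).1
  have h3 := (finrank_singularHomology_zmod_succ (X := N) (p := p) 2).1
  simp only [Nat.reduceAdd] at h2 h3
  -- `H₃(N; ℤ)` is torsion-free
  have ht3 : Nat.log p (Nat.card (zsmulAddGroupHom (α := singularHomology ℤ ℤ N 3) (p : ℤ)).ker) = 0 :=
    log_card_ker_zsmul_eq_zero_of_torsion_eq_bot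
      (torsion_singularHomology_eq_bot_of_isOrientableOver_holds N 3 ⟨μ⟩) p hp.out
  -- Betti symmetry over `𝔽ₚ` and over `ℚ`
  have hq : IsOrientableOver ℚ N 4 := isOrientableOver_of_int_holds N ℚ ⟨μ⟩
  have hzp : IsOrientableOver (ZMod p) N 4 := isOrientableOver_of_int_holds N (ZMod p) ⟨μ⟩
  have e13p := bettiNumber_eq_bettiNumber_of_add_eq_holds (ZMod p) N 4 hzp (show 1 + 3 = 4 by norm_num)
  have e13q := bettiNumber_eq_bettiNumber_of_add_eq_holds ℚ N 4 hq (show 1 + 3 = 4 by norm_num)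
  rw [← bettiNumber_int_eq_rat, ← bettiNumber_int_eq_rat] at e13q
  unfold bettiNumber at h1 e13p e13q ⊢
  refine ⟨h1, ?_⟩
  omega

end ModP

end Summit.SmoothPoincare4.SmoothPoincare4.Theorems.OrigamiRung.PairRigidityEndgame

end
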